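import Mathlib
import HarnessLib
import Summits.ABC.ABC.Theses.CongruentialReceptacle
import Summits.ABC.ABC.Theorems.CongruentialReceptacleCompactBalanceTransferSplit
import Summits.ABC.ABC.Theorems.CongruentialReceptacleCompactBalanceTransferPowerDeep

/-!
# Crux `CompactBalanceTransfer` (stmt-ABC-1725) — the exact shape of child 1 `H → F`: a self-improvement of `H`

Structure lemmas for the registered stub `stub_balancedToFreySzpiro : H → F` of line `birth` (= child 1
`BalancedToFreySzpiro` of the currency split D1, `Cruxes/CompactBalanceTransfer/STRATEGY-CENSUS.md` §4, glue
`Summit.ABC.ABC.Theorems.compactBalanceTransfer_of_subs`), where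

* `H := ∀ κ > 0, ∀ ε > 0, ∃ C, ∀ abc-triples, κc ≤ a → κc ≤ b → c < C · rad(abc)^(1+ε)` — abc on every compactly
  balanced cell, constants ARBITRARY in the balance `κ` (the hypothesis of the crux);
* `F := ∀ ε > 0, ∃ C, ∀ abc-triples, (abc)² ≤ C · rad(abc)^(6+ε)` — Szpiro `6+ε` for the Frey curves of ALL triples in
  the route's elementary currency;
* `P := ∀ ε > 0, ∃ A, ∀ κ > 0, ∀ κ-balanced abc-triples, c < A · κ^(−1/3) · rad(abc)^(1+ε)` — balanced abc with constants
  POLYNOMIAL (`κ^(−1/3)`) in the balance, uniform down to `κ → 0`.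

Results (census S6 made exact; first written sorry-free by lead c2 in
`Cruxes/CompactBalanceTransfer/Lines/birth_stub1_selfimprovement.lean`, restated here WITHOUT `def`s so that the
future child-1 item can import them):

* `polyBalanced_of_freySzpiroAll : F → P` — on the cell `(abc)² ≥ κ²c⁶/4`;
* `freySzpiroAll_of_polyBalanced : P → F` — apply `P` at the triple's OWN balance `κ := min(a,b)/c`, where `abc ≤ κc³`;
* `freySzpiroAll_iff_polyBalanced : F ↔ P`;
* `balancedToFreySzpiro_iff_selfImprovement : (H → F) ↔ (H → P)` — child 1 says EXACTLY that balanced abc upgrades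
  its own constants from arbitrary `C(κ,ε)` to `A_ε·κ^(−1/3)` (a qualitative-to-quantitative self-improvement of the
  hypothesis; at `κ = 1/c` the statement `P` contains `c < A·rad^(3/2+ε)`-type content on `a = 1`);
* `balancedABC_of_polyBalanced : P → H` (trivial) and `polyBalanced_of_abc : ABC → P` — the sandwich `ABC ⇒ P ⇒ H`.

No `def`s; unconditional; standard axioms; no named facts.
-/

-- `Summit.<Summit>.<Problem>`: for the single-conjunct summit `ABC` the duplicate `ABC.ABC` is mandated.
set_option linter.dupNamespace false

namespace Summit.ABC.ABC.Theorems.CompactBalanceTransfer.SelfImprovement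

open Literature.NumberTheory.DiophantineGeometry
open Summit.ABC.ABC.Theses.CongruentialReceptacle
open Summit.ABC.ABC.Theorems.CompactBalanceTransfer.PowerDeep (rad_pos_nat)

/-- `P → H`: specialise the uniform constant `A·κ^(−1/3)` at the given `κ`. [folklore] -/
theorem balancedABC_of_polyBalanced
    (hP : ∀ ε : ℝ, 0 < ε → ∃ A : ℝ, ∀ κ : ℝ, 0 < κ → ∀ a b c : ℕ, IsABCTriple a b c →
      κ * (c : ℝ) ≤ (a : ℝ) → κ * (c : ℝ) ≤ (b : ℝ) →
        (c : ℝ) < A * κ ^ (-(1 / 3 : ℝ)) * ((rad a b c : ℕ) : ℝ) ^ (1 + ε)) :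
    ∀ κ : ℝ, 0 < κ → ∀ ε : ℝ, 0 < ε → ∃ C : ℝ, ∀ a b c : ℕ, IsABCTriple a b c →
      κ * (c : ℝ) ≤ (a : ℝ) → κ * (c : ℝ) ≤ (b : ℝ) → (c : ℝ) < C * ((rad a b c : ℕ) : ℝ) ^ (1 + ε) := by
  intro κ hκ ε hε
  obtain ⟨A, hA⟩ := hP ε hε
  exact ⟨A * κ ^ (-(1 / 3 : ℝ)), fun a b c h ha hb => hA κ hκ a b c h ha hb⟩

/-- **`F → P`.** On the cell `min(a,b) ≥ κc` one has `ab ≥ κc·(c/2)`, so `(abc)² ≥ κ²c⁶/4`, and `F` at `6ε` gives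
`c⁶ ≤ 4C·κ⁻²·rad^(6+6ε)`, i.e. `c ≤ (4C)^(1/6)·κ^(−1/3)·rad^(1+ε)`. [folklore] -/
theorem polyBalanced_of_freySzpiroAll
    (hF : ∀ ε : ℝ, 0 < ε → ∃ C : ℝ, ∀ a b c : ℕ, IsABCTriple a b c →
      ((a * b * c : ℕ) : ℝ) ^ 2 ≤ C * ((rad a b c : ℕ) : ℝ) ^ (6 + ε)) :
    ∀ ε : ℝ, 0 < ε → ∃ A : ℝ, ∀ κ : ℝ, 0 < κ → ∀ a b c : ℕ, IsABCTriple a b c →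
      κ * (c : ℝ) ≤ (a : ℝ) → κ * (c : ℝ) ≤ (b : ℝ) →
        (c : ℝ) < A * κ ^ (-(1 / 3 : ℝ)) * ((rad a b c : ℕ) : ℝ) ^ (1 + ε) := by
  intro ε hε
  obtain ⟨C, hC⟩ := hF (6 * ε) (by positivity)
  set C' : ℝ := max C 1 with hC'def
  have hC'1 : (1 : ℝ) ≤ C' := le_max_right _ _
  have hC'pos : (0 : ℝ) < C' := lt_of_lt_of_le one_pos hC'1
  set K : ℝ := (Real.log 4 + Real.log C') / 6 with hKdef
  refine ⟨Real.exp K + 1, fun κ hκ a b c habc ha hb => ?_⟩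
  have hF0 := hC a b c habc
  obtain ⟨ha0, hb0, hsum, _⟩ := habc
  have hcpos : (0 : ℝ) < c := by exact_mod_cast (show 0 < c by omega)
  have hapos : (0 : ℝ) < a := by exact_mod_cast ha0
  have hbpos : (0 : ℝ) < b := by exact_mod_cast hb0
  have hRpos : (0 : ℝ) < ((rad a b c : ℕ) : ℝ) := by exact_mod_cast rad_pos_nat a b c
  have hκR : 0 < κ ^ (-(1 / 3 : ℝ)) * ((rad a b c : ℕ) : ℝ) ^ (1 + ε) :=
    mul_pos (Real.rpow_pos_of_pos hκ _) (Real.rpow_pos_of_pos hRpos _)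
  -- F in logs: 2 log(abc) ≤ log C' + (6+6ε) log R
  have hXnn : (0 : ℝ) ≤ ((rad a b c : ℕ) : ℝ) ^ (6 + 6 * ε) := Real.rpow_nonneg hRpos.le _
  have hXpos : (0 : ℝ) < ((rad a b c : ℕ) : ℝ) ^ (6 + 6 * ε) := Real.rpow_pos_of_pos hRpos _
  have hF1 : ((a * b * c : ℕ) : ℝ) ^ 2 ≤ C' * ((rad a b c : ℕ) : ℝ) ^ (6 + 6 * ε) :=
    le_trans hF0 (mul_le_mul_of_nonneg_right (le_max_left _ _) hXnn)
  have habcpos : (0 : ℝ) < ((a * b * c : ℕ) : ℝ) := by push_cast; positivity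
  have hlogF : 2 * Real.log ((a * b * c : ℕ) : ℝ) ≤
      Real.log C' + (6 + 6 * ε) * Real.log ((rad a b c : ℕ) : ℝ) := by
    have h := Real.log_le_log (by positivity) hF1
    have e2 : Real.log (((a * b * c : ℕ) : ℝ) ^ 2) = 2 * Real.log ((a * b * c : ℕ) : ℝ) := by
      rw [Real.log_pow]; norm_num
    rw [e2, Real.log_mul hC'pos.ne' hXpos.ne', Real.log_rpow hRpos] at h
    linarith
  -- lower bound on the cell: log(abc) ≥ log κ + 3 log c − log 2
  have e : Real.log ((a * b * c : ℕ) : ℝ) = Real.log a + Real.log b + Real.log c := by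
    push_cast
    rw [Real.log_mul (by positivity) hcpos.ne', Real.log_mul hapos.ne' hbpos.ne']
  have hκc : Real.log κ + Real.log c = Real.log (κ * c) := (Real.log_mul hκ.ne' hcpos.ne').symm
  have hloga : Real.log (κ * c) ≤ Real.log a := Real.log_le_log (mul_pos hκ hcpos) ha
  have hlogb : Real.log (κ * c) ≤ Real.log b := Real.log_le_log (mul_pos hκ hcpos) hb
  have hlow : Real.log κ + 3 * Real.log c - Real.log 2 ≤ Real.log ((a * b * c : ℕ) : ℝ) := by
    rcases le_total a b with hab | hab
    · have hb2 : (c : ℝ) ≤ 2 * (b : ℝ) := by exact_mod_cast (show c ≤ 2 * b by omega)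
      have hlb : Real.log c ≤ Real.log 2 + Real.log b := by
        have := Real.log_le_log hcpos hb2
        rwa [Real.log_mul (by norm_num) hbpos.ne'] at this
      rw [e]; linarith
    · have ha2 : (c : ℝ) ≤ 2 * (a : ℝ) := by exact_mod_cast (show c ≤ 2 * a by omega)
      have hla : Real.log c ≤ Real.log 2 + Real.log a := by
        have := Real.log_le_log hcpos ha2
        rwa [Real.log_mul (by norm_num) hapos.ne'] at this
      rw [e]; linarith
  -- combine: 6 log c ≤ log C' + 2 log 2 − 2 log κ + (6+6ε) log R
  have hlog4 : Real.log 4 = 2 * Real.log 2 := by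
    rw [show (4 : ℝ) = 2 ^ 2 by norm_num, Real.log_pow]; norm_num
  have hlogc : Real.log c ≤ K + (-(1 / 3 : ℝ)) * Real.log κ + (1 + ε) * Real.log ((rad a b c : ℕ) : ℝ) := by
    rw [hKdef, hlog4]; linarith
  have hcle : (c : ℝ) ≤ Real.exp K * (κ ^ (-(1 / 3 : ℝ)) * ((rad a b c : ℕ) : ℝ) ^ (1 + ε)) := by
    calc (c : ℝ) = Real.exp (Real.log c) := (Real.exp_log hcpos).symm
      _ ≤ Real.exp (K + (-(1 / 3 : ℝ)) * Real.log κ + (1 + ε) * Real.log ((rad a b c : ℕ) : ℝ)) :=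
          Real.exp_le_exp.mpr hlogc
      _ = Real.exp K * (κ ^ (-(1 / 3 : ℝ)) * ((rad a b c : ℕ) : ℝ) ^ (1 + ε)) := by
          rw [Real.exp_add, Real.exp_add, Real.rpow_def_of_pos hκ, Real.rpow_def_of_pos hRpos,
            mul_comm (Real.log κ), mul_comm (Real.log _) (1 + ε), mul_assoc]
  calc (c : ℝ) ≤ Real.exp K * (κ ^ (-(1 / 3 : ℝ)) * ((rad a b c : ℕ) : ℝ) ^ (1 + ε)) := hcle
    _ < Real.exp K * (κ ^ (-(1 / 3 : ℝ)) * ((rad a b c : ℕ) : ℝ) ^ (1 + ε)) +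
          1 * (κ ^ (-(1 / 3 : ℝ)) * ((rad a b c : ℕ) : ℝ) ^ (1 + ε)) := by linarith
    _ = (Real.exp K + 1) * κ ^ (-(1 / 3 : ℝ)) * ((rad a b c : ℕ) : ℝ) ^ (1 + ε) := by ring

/-- **`P → F`.** Apply `P` at the triple's own balance `κ := min(a,b)/c`: then `abc ≤ κc³` and
`c < A·κ^(−1/3)·rad^(1+ε/6)` gives `(abc)² ≤ (κc³)² < A⁶·rad^(6+ε)`. [folklore] -/
theorem freySzpiroAll_of_polyBalanced
    (hP : ∀ ε : ℝ, 0 < ε → ∃ A : ℝ, ∀ κ : ℝ, 0 < κ → ∀ a b c : ℕ, IsABCTriple a b c →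
      κ * (c : ℝ) ≤ (a : ℝ) → κ * (c : ℝ) ≤ (b : ℝ) →
        (c : ℝ) < A * κ ^ (-(1 / 3 : ℝ)) * ((rad a b c : ℕ) : ℝ) ^ (1 + ε)) :
    ∀ ε : ℝ, 0 < ε → ∃ C : ℝ, ∀ a b c : ℕ, IsABCTriple a b c →
      ((a * b * c : ℕ) : ℝ) ^ 2 ≤ C * ((rad a b c : ℕ) : ℝ) ^ (6 + ε) := by
  intro ε hε
  obtain ⟨A, hA⟩ := hP (ε / 6) (by positivity)
  refine ⟨(max A 1) ^ 6, fun a b c habc => ?_⟩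
  have habc' := habc
  obtain ⟨ha0, hb0, hsum, _⟩ := habc'
  have hcpos : (0 : ℝ) < c := by exact_mod_cast (show 0 < c by omega)
  have hapos : (0 : ℝ) < a := by exact_mod_cast ha0
  have hbpos : (0 : ℝ) < b := by exact_mod_cast hb0
  have hRpos : (0 : ℝ) < ((rad a b c : ℕ) : ℝ) := by exact_mod_cast rad_pos_nat a b c
  have hR1 : (1 : ℝ) ≤ ((rad a b c : ℕ) : ℝ) := by exact_mod_cast rad_pos_nat a b c
  have hlogR : 0 ≤ Real.log ((rad a b c : ℕ) : ℝ) := Real.log_nonneg hR1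
  -- the triple's own balance
  set m : ℕ := min a b with hmdef
  have hmpos : (0 : ℝ) < (m : ℝ) := by
    have : 0 < m := by rw [hmdef]; exact lt_min ha0 hb0
    exact_mod_cast this
  set κ : ℝ := (m : ℝ) / (c : ℝ) with hκdef
  have hκpos : 0 < κ := div_pos hmpos hcpos
  have hκc : κ * (c : ℝ) = (m : ℝ) := by rw [hκdef]; field_simp
  have hma : κ * (c : ℝ) ≤ (a : ℝ) := by
    rw [hκc]; exact_mod_cast (min_le_left a b)
  have hmb : κ * (c : ℝ) ≤ (b : ℝ) := by
    rw [hκc]; exact_mod_cast (min_le_right a b)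
  have hP0 := hA κ hκpos a b c habc hma hmb
  -- upgrade A to A' = max A 1 ≥ 1
  set A' : ℝ := max A 1 with hA'def
  have hA'1 : (1 : ℝ) ≤ A' := le_max_right _ _
  have hA'pos : (0 : ℝ) < A' := lt_of_lt_of_le one_pos hA'1
  have hY : 0 < κ ^ (-(1 / 3 : ℝ)) * ((rad a b c : ℕ) : ℝ) ^ (1 + ε / 6) :=
    mul_pos (Real.rpow_pos_of_pos hκpos _) (Real.rpow_pos_of_pos hRpos _)
  have hP1 : (c : ℝ) < A' * κ ^ (-(1 / 3 : ℝ)) * ((rad a b c : ℕ) : ℝ) ^ (1 + ε / 6) := by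
    have : A * κ ^ (-(1 / 3 : ℝ)) * ((rad a b c : ℕ) : ℝ) ^ (1 + ε / 6) ≤
        A' * κ ^ (-(1 / 3 : ℝ)) * ((rad a b c : ℕ) : ℝ) ^ (1 + ε / 6) := by
      rw [mul_assoc, mul_assoc]
      exact mul_le_mul_of_nonneg_right (le_max_left _ _) hY.le
    linarith
  -- in logs: log c < log A' − (1/3)(log m − log c) + (1+ε/6) log R
  have hlogP : Real.log c <
      Real.log A' + (-(1 / 3 : ℝ)) * (Real.log m - Real.log c) +
        (1 + ε / 6) * Real.log ((rad a b c : ℕ) : ℝ) := by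
    have h := Real.log_lt_log hcpos hP1
    rw [Real.log_mul (mul_pos hA'pos (Real.rpow_pos_of_pos hκpos _)).ne'
        (Real.rpow_pos_of_pos hRpos _).ne',
      Real.log_mul hA'pos.ne' (Real.rpow_pos_of_pos hκpos _).ne', Real.log_rpow hκpos,
      Real.log_rpow hRpos, hκdef, Real.log_div hmpos.ne' hcpos.ne'] at h
    exact h
  -- log(abc) ≤ log m + 2 log c
  have e : Real.log ((a * b * c : ℕ) : ℝ) = Real.log a + Real.log b + Real.log c := by
    push_cast
    rw [Real.log_mul (by positivity) hcpos.ne', Real.log_mul hapos.ne' hbpos.ne']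
  have hac : Real.log a ≤ Real.log c := Real.log_le_log hapos (by exact_mod_cast (show a ≤ c by omega))
  have hbc : Real.log b ≤ Real.log c := Real.log_le_log hbpos (by exact_mod_cast (show b ≤ c by omega))
  have hup : Real.log ((a * b * c : ℕ) : ℝ) ≤ Real.log m + 2 * Real.log c := by
    rcases le_total a b with hab | hab
    · have hm : (m : ℝ) = (a : ℝ) := by rw [hmdef, min_eq_left hab]
      rw [e, hm]; linarith
    · have hm : (m : ℝ) = (b : ℝ) := by rw [hmdef, min_eq_right hab]
      rw [e, hm]; linarith
  -- combine: 2 log(abc) < 6 log A' + (6+ε) log R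
  have hcomb : 2 * Real.log ((a * b * c : ℕ) : ℝ) <
      6 * Real.log A' + (6 + ε) * Real.log ((rad a b c : ℕ) : ℝ) := by nlinarith
  have habcpos : (0 : ℝ) < ((a * b * c : ℕ) : ℝ) := by push_cast; positivity
  have hfin : ((a * b * c : ℕ) : ℝ) ^ 2 < A' ^ 6 * ((rad a b c : ℕ) : ℝ) ^ (6 + ε) := by
    have hrhs : (0 : ℝ) < A' ^ 6 * ((rad a b c : ℕ) : ℝ) ^ (6 + ε) :=
      mul_pos (by positivity) (Real.rpow_pos_of_pos hRpos _)
    have h1 : Real.log (((a * b * c : ℕ) : ℝ) ^ 2) <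
        Real.log (A' ^ 6 * ((rad a b c : ℕ) : ℝ) ^ (6 + ε)) := by
      have e1 : Real.log (((a * b * c : ℕ) : ℝ) ^ 2) = 2 * Real.log ((a * b * c : ℕ) : ℝ) := by
        rw [Real.log_pow]; norm_num
      have e2 : Real.log (A' ^ 6 * ((rad a b c : ℕ) : ℝ) ^ (6 + ε)) =
          6 * Real.log A' + (6 + ε) * Real.log ((rad a b c : ℕ) : ℝ) := by
        rw [Real.log_mul (by positivity) (Real.rpow_pos_of_pos hRpos _).ne', Real.log_pow,
          Real.log_rpow hRpos]
        norm_num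
      rw [e1, e2]; exact hcomb
    exact (Real.log_lt_log_iff (by positivity) hrhs).mp h1
  exact hfin.le

/-- **`F ↔ P`** (census S6, exact): Szpiro `6+ε` for the Frey curves of all abc-triples (elementary currency) is the
same statement as balanced abc with `κ^(−1/3)`-polynomial constants. [folklore] -/
theorem freySzpiroAll_iff_polyBalanced :
    (∀ ε : ℝ, 0 < ε → ∃ C : ℝ, ∀ a b c : ℕ, IsABCTriple a b c →
        ((a * b * c : ℕ) : ℝ) ^ 2 ≤ C * ((rad a b c : ℕ) : ℝ) ^ (6 + ε)) ↔
      (∀ ε : ℝ, 0 < ε → ∃ A : ℝ, ∀ κ : ℝ, 0 < κ → ∀ a b c : ℕ, IsABCTriple a b c →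
        κ * (c : ℝ) ≤ (a : ℝ) → κ * (c : ℝ) ≤ (b : ℝ) →
          (c : ℝ) < A * κ ^ (-(1 / 3 : ℝ)) * ((rad a b c : ℕ) : ℝ) ^ (1 + ε)) :=
  ⟨polyBalanced_of_freySzpiroAll, freySzpiroAll_of_polyBalanced⟩

/-- **Child 1 of the currency split is a self-improvement statement for `H`.** `(H → F) ↔ (H → P)`: the
registered stub `stub_balancedToFreySzpiro` of line `birth` (= child `BalancedToFreySzpiro` of D1) says exactly that
abc on the compactly balanced cells upgrades its own constants from arbitrary `C(κ,ε)` to `A_ε·κ^(−1/3)`, uniformly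
down to `κ → 0`. [folklore] -/
theorem balancedToFreySzpiro_iff_selfImprovement :
    ((∀ κ : ℝ, 0 < κ → ∀ ε : ℝ, 0 < ε → ∃ C : ℝ, ∀ a b c : ℕ, IsABCTriple a b c →
          κ * (c : ℝ) ≤ (a : ℝ) → κ * (c : ℝ) ≤ (b : ℝ) → (c : ℝ) < C * ((rad a b c : ℕ) : ℝ) ^ (1 + ε)) →
        ∀ ε : ℝ, 0 < ε → ∃ C : ℝ, ∀ a b c : ℕ, IsABCTriple a b c →
          ((a * b * c : ℕ) : ℝ) ^ 2 ≤ C * ((rad a b c : ℕ) : ℝ) ^ (6 + ε)) ↔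
      ((∀ κ : ℝ, 0 < κ → ∀ ε : ℝ, 0 < ε → ∃ C : ℝ, ∀ a b c : ℕ, IsABCTriple a b c →
          κ * (c : ℝ) ≤ (a : ℝ) → κ * (c : ℝ) ≤ (b : ℝ) → (c : ℝ) < C * ((rad a b c : ℕ) : ℝ) ^ (1 + ε)) →
        ∀ ε : ℝ, 0 < ε → ∃ A : ℝ, ∀ κ : ℝ, 0 < κ → ∀ a b c : ℕ, IsABCTriple a b c →
          κ * (c : ℝ) ≤ (a : ℝ) → κ * (c : ℝ) ≤ (b : ℝ) →
            (c : ℝ) < A * κ ^ (-(1 / 3 : ℝ)) * ((rad a b c : ℕ) : ℝ) ^ (1 + ε)) :=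
  ⟨fun h hH => polyBalanced_of_freySzpiroAll (h hH), fun h hH => freySzpiroAll_of_polyBalanced (h hH)⟩

/-- The sandwich `ABC ⇒ P ⇒ H`, upper half: `ABC → P` (through `ABC → F`,
`Summit.ABC.ABC.Theorems.freySzpiroAll_of_abc`, and `F → P`). [folklore] -/
theorem polyBalanced_of_abc (h : _root_.ABC) :
    ∀ ε : ℝ, 0 < ε → ∃ A : ℝ, ∀ κ : ℝ, 0 < κ → ∀ a b c : ℕ, IsABCTriple a b c →
      κ * (c : ℝ) ≤ (a : ℝ) → κ * (c : ℝ) ≤ (b : ℝ) →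
        (c : ℝ) < A * κ ^ (-(1 / 3 : ℝ)) * ((rad a b c : ℕ) : ℝ) ^ (1 + ε) :=
  polyBalanced_of_freySzpiroAll (fun ε hε => Summit.ABC.ABC.Theorems.freySzpiroAll_of_abc h ε hε)

/-- Under `H`, child 1 of the split is equivalent to `P` itself, and the crux to `ABC`; in particular the crux gives
child 1 (`compactBalanceTransfer_iff_subs`) and hence, under `H`, the polynomial constants:
`CompactBalanceTransfer → H → P`. [folklore] -/
theorem polyBalanced_of_compactBalanceTransfer (hT : CompactBalanceTransfer)
    (hH : ∀ κ : ℝ, 0 < κ → ∀ ε : ℝ, 0 < ε → ∃ C : ℝ, ∀ a b c : ℕ, IsABCTriple a b c →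
      κ * (c : ℝ) ≤ (a : ℝ) → κ * (c : ℝ) ≤ (b : ℝ) → (c : ℝ) < C * ((rad a b c : ℕ) : ℝ) ^ (1 + ε)) :
    ∀ ε : ℝ, 0 < ε → ∃ A : ℝ, ∀ κ : ℝ, 0 < κ → ∀ a b c : ℕ, IsABCTriple a b c →
      κ * (c : ℝ) ≤ (a : ℝ) → κ * (c : ℝ) ≤ (b : ℝ) →
        (c : ℝ) < A * κ ^ (-(1 / 3 : ℝ)) * ((rad a b c : ℕ) : ℝ) ^ (1 + ε) :=
  polyBalanced_of_abc (hT hH)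

end Summit.ABC.ABC.Theorems.CompactBalanceTransfer.SelfImprovement
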